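import Mathlib
import HarnessLib
import Summits.ResolutionOfSingularities.ResolutionOfSingularities.Theorems.HomologicalConductorNoZenoCaInvertibleRational
import Summits.ResolutionOfSingularities.ResolutionOfSingularities.Theorems.HomologicalConductorNoZenoCaInvertibleMinRes
import Summits.ResolutionOfSingularities.ResolutionOfSingularities.Theorems.HomologicalConductorNoZenoGWH2ResolutionHolds

/-!
# Crux `NoZenoR` (stmt-ResolutionOfSingularities-19943) / kill test `SurfaceTermination` (stmt-16488):
# THEOREM A (`ca(T)·𝒪_X` invertible) WITHOUT the Görtz–Wedhorn named fact

Route `ResolutionOfSingularities/HomologicalConductor` (cell decomp-res, hand leafhand-res-homologicalconduct-3 g1).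
OURS: AI-written, weaker than expert review; nothing here is a statement of the manuscript under review
(Hironaka 2017).  SUPPORT level, counted 0.  Def-free, no new named facts.

The registered six-fact bundle of the kill test (`stub_publishedSurfaceFacts`: Cossart–Jannsen–Saito 2020 Thm 1.2,
Lipman 1969 (1.2), (4.1), (12.1)(i), (12.1)(ii), Görtz–Wedhorn II Cor. 24.44) enters THEOREM A — `stub_caInvertibleMinRes`
(p513073) and its strong form `caInvertible_of_hasTrivialCechH1` — through the binder
`hGW : GortzWedhorn2023_24_44_H2` at exactly two places: G2 (iii)/(iv) (`FullSheaf.fullSheaf_isFiniteLocallyFree`) and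
LEMMA L (`LemmaL.lemmaL_of_GW`), both at a RESOLUTION `π : X ⟶ Spec T` of a two-dimensional Noetherian local domain.
That instance of Cor. 24.44 is a THEOREM of the tree: `NoZeno.gwH2ResolutionDim2_holds` (route (δ), p-landed file
`…NoZenoGWH2ResolutionHolds`: Stacks 081T domination by a blow-up + the projective case of 24.44 + local Serre vanishing;
no theorem on formal functions).  This file re-derives THEOREM A over that theorem:

* `lemmaL_holds` — LEMMA L with its side conditions discharged, NO named fact (twin of `lemmaL_of_GW`);
* `fullSheaf_isFiniteLocallyFree_holds` — G2 (iv), NO named fact (twin of `fullSheaf_isFiniteLocallyFree`, through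
  the tree's `fullSheaf_cechMH1_subsingleton_instRes`);
* `caInvertible_of_hasTrivialCechH1'` — THEOREM A, strong form, modulo Lipman (12.1)(ii) ONLY (was: + 24.44);
* `caInvertibleMinRes_of_two_facts` — the registered stub text `stub_caInvertibleMinRes` modulo Lipman (1.2) and
  (12.1)(ii) ONLY (was: the six-fact bundle).

Consequence (files `…NoZenoSurfaceCoreFourFacts`, `…SurfaceTerminationReductionFourFacts`): the sandwich core, the
kill-test reduction `surfaceTermination_of_strictDrop` and the crux door `noZenoR_of_facts_of_topDim` hold modulo FOUR
prints {CJS 2020 Thm 1.2, Lipman (1.2), (4.1), (12.1)(ii)} — Görtz–Wedhorn 24.44 is discharged and Lipman (12.1)(i) is idle.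
No crux, kill test or summit statement is proved here.
-/

noncomputable section
set_option linter.dupNamespace false

namespace Summit.ResolutionOfSingularities.ResolutionOfSingularities.Theorems.NoZeno.SandwichCluster

open CategoryTheory CategoryTheory.Abelian AlgebraicGeometry TopologicalSpace IsLocalRing Order
open Literature.RingTheory.CohomologyAnnihilator (cohomologyAnnihilator)
open Literature.AlgebraicGeometry.Morphisms Literature.AlgebraicGeometry.Modules
open Literature.AlgebraicGeometry.Resolution Literature.AlgebraicGeometry.Motives
open Summit.ResolutionOfSingularities.ResolutionOfSingularities.Theorems.NoZeno.Birth

namespace FourFacts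

section General

variable {T : Type} [CommRing T] [IsDomain T] [IsNoetherianRing T] [IsIntegrallyClosed T] [IsLocalRing T]
  {X : Scheme.{0}} [IsIntegral X] [IsLocallyNoetherian X] (π : X ⟶ Spec (.of T))

/-- **LEMMA L, side conditions discharged, NO named fact** (twin of `LemmaL.lemmaL_of_GW`): for `T` a Noetherian local
normal domain of Krull dimension `2`, not regular, `π : X → Spec T` a resolution, `F` affine-localizing, `𝒰` a finite
affine open cover and `𝔪ᶜ ≤ 𝔞 = ann_T Ȟ¹(𝒰, F)`: if at every maximal point `η` of the closed fibre some non-zero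
`a ∈ 𝔞` has `ord_η a ≤ ord_η t`, then `t ∈ 𝔞`.  Right exactness of `Ȟ¹` comes from the tree theorem
`GWH2ResolutionDim2.cechMapH1_surjective_holds` instead of Görtz–Wedhorn 24.44. [this work; composition of tree results] -/
theorem lemmaL_holds (hπ : IsResolution π)
    (h2 : ringKrullDim T = 2) (hsing : ¬ IsRegularLocalRing T)
    (F : X.Modules) (hF : IsAffineLocalizing F) (ι : Type) [Finite ι] (U : ι → X.Opens)
    (hUaff : ∀ i, IsAffineOpen (U i)) (hUcov : ⨆ i, U i = ⊤)
    (c : ℕ) (hc : maximalIdeal T ^ c ≤ Module.annihilator T (CechMH1 π F U)) (t : T)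
    (ht : ∀ η ∈ excPoints π, ∃ a ∈ Module.annihilator T (CechMH1 π F U),
      a ≠ 0 ∧ Scheme.ord (baseToFunctionField π a) η ≤ Scheme.ord (baseToFunctionField π t) η) :
    t ∈ Module.annihilator T (CechMH1 π F U) := by
  haveI : IsProper π := hπ.isProper
  have hRE : ∀ S : ShortComplex X.Modules, S.ShortExact → IsAffineLocalizing S.X₁ →
      Function.Surjective (cechMapH1 π S.g U) := fun S hS h₁ =>
    GWH2ResolutionDim2.cechMapH1_surjective_holds h2 π hπ U hS h₁ hUaff hUcov
  obtain ⟨Z, hZ⟩ := LemmaL.annihilator_cechMH1_isCarried_coheight π hπ h2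
    (LemmaL.baseToFunctionField_injective π hπ) F hF U hUaff hRE hc
  refine (hZ t).mpr ?_
  by_cases ht0 : t = 0
  · exact Or.inl ht0
  refine Or.inr fun ζ hζ𝔪 hζ => ?_
  have hζexc : ζ ∈ excPoints π :=
    hπ.excCurvePoints_subset_excPoints h2 (hπ.mem_excCurvePoints_of_coheight_eq_one h2 hsing hζ𝔪 hζ)
  obtain ⟨a, ha𝔞, ha0, hle⟩ := ht ζ hζexc
  rcases (hZ a).mp ha𝔞 with h | h
  · exact absurd h ha0
  · exact (h ζ hζ𝔪 hζ).trans hle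

/-- **G2 (iv), NO named fact** (twin of `FullSheaf.fullSheaf_isFiniteLocallyFree`): the full sheaf `𝒪_X · φ(M)` of a
finitely generated reflexive module over the two-dimensional Noetherian normal local domain `T` is finite locally free
on any resolution `π : X ⟶ Spec T` with `Ȟ¹(𝒰, 𝒪_X) = 0`; the `Ȟ² = 0` input is the tree theorem
`gwH2ResolutionDim2_holds` through `fullSheaf_cechMH1_subsingleton_instRes`. [this work; composition of tree results] -/
theorem fullSheaf_isFiniteLocallyFree_holds (M : Type) [AddCommGroup M] [Module T M] [Module.Finite T M]
    {r : ℕ} (φ : M →+ (Fin r → X.functionField)) (hdim : ringKrullDim T = 2) (hπ : IsResolution π)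
    (hrat : HasTrivialCechH1 π) (hM : Module.IsReflexive T M)
    (hφ : ∀ (a : T) (m : M), φ (a • m) = baseToFunctionField π a • φ m) (hφinj : Function.Injective φ) :
    IsFiniteLocallyFree (FullSheaf.generatedSheaf (X := X) (Fin r → X.functionField) (Set.range φ)) :=
  FullSheaf.fullSheaf_isFiniteLocallyFree_of_cechH1 π φ hdim hπ hM hφ hφinj
    fun _ _ U hU hcov =>
      FullSheaf.fullSheaf_cechMH1_subsingleton_instRes T X π M φ hdim hπ hrat gwH2ResolutionDim2_holds hφ U hU hcov

/-- **THEOREM A, strong form, modulo Lipman (12.1)(ii) ONLY** (twin of `caInvertible_of_hasTrivialCechH1`, same proof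
with G2 (iv) and LEMMA L taken from `fullSheaf_isFiniteLocallyFree_holds` / `lemmaL_holds`): for `T` a two-dimensional
Noetherian local normal domain with `𝔪^c ⊆ ca(T)`, ANY resolution `π : X ⟶ Spec T` with `H¹(X, 𝒪_X) = 0` and ANY point
`x ∈ X`, the extension `ca(T)·𝒪_{X,x}` is principal. [cite: Lipman1969, Theorem (12.1) (ii) (p. 220)] -/
theorem caInvertible_of_hasTrivialCechH1'
    (h121ii : Lipman1969_12_1_ii.{0})
    (hdim2 : ringKrullDim T = 2) (hca : ∃ c : ℕ, maximalIdeal T ^ c ≤ cohomologyAnnihilator T)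
    (hπ : IsResolution π) (hrat : HasTrivialCechH1 π) (x : X) :
    (Ideal.map (((X.presheaf.germ ⊤ x trivial).hom.comp
      (π.appTop.hom.comp (Scheme.ΓSpecIso (CommRingCat.of T)).inv.hom)) : T →+* X.presheaf.stalk x)
      (cohomologyAnnihilator T)).IsPrincipal := by
  classical
  -- a REGULAR `T` has `ca(T) = T`, whose extension is the unit ideal
  by_cases hsing : IsRegularLocalRing T
  · rw [Literature.RingTheory.CohomologyAnnihilator.cohomologyAnnihilator_eq_top_of_isRegularLocalRing T,
      Ideal.map_top]
    exact top_isPrincipal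
  haveI : IsProper π := hπ.isProper
  -- `ca` is `𝔪`-primary with a non-zero element
  obtain ⟨c, hc⟩ := hca
  have hm : maximalIdeal T ≠ ⊥ := fun h =>
    hsing (isRegularLocalRing_of_isField (IsLocalRing.isField_iff_maximalIdeal_eq.mpr h))
  obtain ⟨y, hy, hy0⟩ := (maximalIdeal T ^ c).ne_bot_iff.mp (pow_ne_zero c hm)
  have hyca : y ∈ cohomologyAnnihilator T := hc hy
  -- (S1) G2-MAIN, consumed form, with G2 (iv) from `fullSheaf_isFiniteLocallyFree_holds`
  have hG2 : ∀ (M : Type) [AddCommGroup M] [Module T M] [Module.Finite T M],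
      Module.IsReflexive T M →
      (∀ e : Ext (ModuleCat.of T M) (ModuleCat.of T T) 1, e = 0) →
      ∃ F : X.Modules, IsAffineLocalizing F ∧
        ∀ (ι : Type) [Finite ι] (U : ι → X.Opens), (∀ i, IsAffineOpen (U i)) → ⨆ i, U i = ⊤ →
          Nonempty (StableEnd T M ≃ₗ[T] CechMH1 π F U) := by
    intro M _ _ _ hM hW
    obtain ⟨F, -, haff, -, hcov⟩ :=
      FullSheaf.exists_locallyFree_stableEnd_equiv_cechMH1_of_inputs π M hπ hM
        (fun r φ hφ hφinj => fullSheaf_isFiniteLocallyFree_holds π M φ hdim2 hπ hrat hM hφ hφinj)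
        (fun r φ hφ hφinj ι _ U hU hcov =>
          FullSheaf.fullSheaf_dual_cechMH1_subsingleton T X π M φ hπ hrat hW hφ hφinj U hU hcov)
    exact ⟨F, haff, hcov⟩
  -- (S2) LEMMA L, fact-free (`lemmaL_holds`)
  have hL : ∀ (F : X.Modules), IsAffineLocalizing F →
      ∀ (ι : Type) [Finite ι] (U : ι → X.Opens), (∀ i, IsAffineOpen (U i)) → ⨆ i, U i = ⊤ →
      ∀ c : ℕ, maximalIdeal T ^ c ≤ Module.annihilator T (CechMH1 π F U) →
      ∀ t : T, (∀ η ∈ excPoints π, ∃ a ∈ Module.annihilator T (CechMH1 π F U),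
        a ≠ 0 ∧ Scheme.ord (baseToFunctionField π a) η ≤ Scheme.ord (baseToFunctionField π t) η) →
        t ∈ Module.annihilator T (CechMH1 π F U) :=
    lemmaL_holds π hπ hdim2 hsing
  -- (S3) dictionary: both indexings of the exceptional curves agree
  have hdict : excCurvePoints π = excPoints π :=
    (IsResolution.excPoints_eq_excCurvePoints (π := π) hdim2 hπ hsing).symm
  -- Ga: `ca(T)` is carried
  obtain ⟨Z, hZ⟩ := caCarried_of_inputs π hπ hdim2 hG2 hL hdict c hc y hy0 hyca
  -- Gb: carried ideals of a rational singularity are principal at every stalk (Lipman (12.1)(ii))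
  exact carriedPrincipal_of_carried π h121ii hdim2 hπ hrat Z _ hZ x

end General

/-! ## The registered stub text `stub_caInvertibleMinRes` modulo Lipman (1.2) and (12.1)(ii) only -/

variable {k K : Type} [Field k] [Field K] [Algebra k K]

/-- **THEOREM A in scheme form at a singular sandwiched stage, modulo TWO prints** (the registered text of
`stub_caInvertibleMinRes`, p513073, with its six-fact bundle replaced by Lipman (1.2) — rationality of the stage's
resolutions, `hasTrivialCechH1_of_isResolution_tower` — and Lipman (12.1)(ii)): for a singular sandwiched stage `T_m`
(`m ≥ m₀ + 1`) and any minimal resolution `π : X ⟶ Spec T_m`, `ca(T_m)·𝒪_{X,x}` is principal at every point `x`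
(the closed-fibre restriction `hx` of the registered text is not needed and kept as an idle binder).
[cite: Lipman1969, Proposition (1.2) (p. 199), Theorem (12.1) (ii) (p. 220)] -/
theorem caInvertibleMinRes_of_two_facts
    (h12 : Lipman1969_1_2.{0}) (h121ii : Lipman1969_12_1_ii.{0})
    (p : ℕ) (_hp : p.Prime) (k K : Type) [Field k] [CharP k p] [Field K]
    [Algebra k K] (O : ValuationSubring K) (A R : Subalgebra k K) (m₀ : ℕ)
    (ctx : SandwichCtx O A R m₀) (m : ℕ) (hm : m₀ + 1 ≤ m)
    (hsing : ¬ IsRegularLocalRing ↥(tower O A m))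
    (X : AlgebraicGeometry.Scheme.{0}) (π : X ⟶ AlgebraicGeometry.Spec (CommRingCat.of ↥(tower O A m)))
    (hπ : Literature.AlgebraicGeometry.Resolution.IsMinimalResolution π) (x : X)
    (_hx : IsLocalHom (((X.presheaf.germ ⊤ x trivial).hom.comp
      (π.appTop.hom.comp (AlgebraicGeometry.Scheme.ΓSpecIso (CommRingCat.of ↥(tower O A m))).inv.hom)) :
        ↥(tower O A m) →+* X.presheaf.stalk x)) :
    (Ideal.map (((X.presheaf.germ ⊤ x trivial).hom.comp
      (π.appTop.hom.comp (AlgebraicGeometry.Scheme.ΓSpecIso (CommRingCat.of ↥(tower O A m))).inv.hom)) :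
        ↥(tower O A m) →+* X.presheaf.stalk x)
      (Literature.RingTheory.CohomologyAnnihilator.cohomologyAnnihilator ↥(tower O A m))).IsPrincipal := by
  obtain ⟨hk, hA, hfr, hAO, htr, -⟩ := id ctx
  -- stage package: noetherian, normal, local, two-dimensional
  obtain ⟨hnoeth, hnorm, _, hloc, hdim2, -, -⟩ := stage_package O A R m₀ ctx m hm hsing
  haveI := hnoeth; haveI := hnorm; haveI := hloc
  haveI : IsIntegral X := hπ.1.isIntegral_source
  haveI : IsProper π := hπ.1.isProper
  haveI : IsLocallyNoetherian X := AlgebraicGeometry.LocallyOfFiniteType.isLocallyNoetherian π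
  -- rationality of the stage's resolution (Lipman (1.2)) and `𝔪`-primarity of `ca` (stub-5, fact-free)
  have hrat : HasTrivialCechH1 π := hasTrivialCechH1_of_isResolution_tower h12 O A R m₀ ctx m hm hsing π hπ.1
  obtain ⟨n, rfl⟩ : ∃ n, m = n + 1 := ⟨m - 1, by omega⟩
  obtain ⟨c, hc⟩ := exists_maximalIdeal_pow_le_cohomologyAnnihilator_tower O A hk hA hfr hAO htr n
  exact caInvertible_of_hasTrivialCechH1' π h121ii hdim2 ⟨c, hc⟩ hπ.1 hrat x

end FourFacts

end Summit.ResolutionOfSingularities.ResolutionOfSingularities.Theorems.NoZeno.SandwichCluster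

end
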